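import Literature.Analysis.ODE.AnalyticNemytskii
import HarnessLib

/-!
# Analytic dependence of solutions of ordinary differential equations on initial conditions

Topic `Analysis/ODE`. The `C^ω` (real-analytic) case of Lang, *Differential and Riemannian
Manifolds* (1995), Ch. IV §1, Thm. 1.14 — classically the Cauchy–Poincaré theorem: **the local
flow of a real-analytic vector field is real-analytic jointly in time and initial condition** —
together with the `C^n` cases in one statement over `n : ℕ∞ω`, `1 ≤ n`
(`exists_contDiffOn_localFlow`; the sibling `SmoothDependence.lean` has `n : ℕ∞` only).
Needed for the real-analytic exponential map of a real-analytic Riemannian metric (programme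
towards `Literature.Geometry.Riemannian.buchner1977_cutLocus_triangulable`, Buchner 1977).

The proof is that of `Literature.Analysis.ODE.exists_contDiffOn_flow` verbatim (Robbin 1968 / Lang,
loc. cit.: the implicit function theorem on `C([0,1], E)` applied to the Robbin–Lang map
`T((λ, x), σ) = x + λ ∫₀ f ∘ σ − σ`, Mathlib's Picard–Lindelöf curves), with the one new
ingredient that the Robbin–Lang map of a real-analytic field is real-analytic
(`contDiffAt_robbinMap_withTop`, from the analyticity of the Nemytskii operator,
`Literature.Analysis.ODE.contDiffAt_nemytskii_omega` of `AnalyticNemytskii.lean`); Mathlib's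
implicit function theorem (`ContDiffAt.implicitFunction`) is stated for every `n : ℕ∞ω`, so the
implicit function is `C^ω` when `T` is.

* `contDiffAt_robbinMap_withTop` — the Robbin–Lang map of a `C^n` field, `n : ℕ∞ω`, is `C^n`;
* `exists_contDiffOn_localFlow` — Lang's Thm. 1.14 for `n : ℕ∞ω`, `1 ≤ n` (so `n = ω` allowed);
* `exists_analyticOn_localFlow` — the analytic case spelled out: for `f` real-analytic on an open
  `U ∋ x₀` there are `r, ε > 0` and a local flow `φ` with `(x, t) ↦ φ x t` real-analytic on
  `B_r(x₀) × (-ε, ε)`.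

No named facts; everything is proved.

## References

* S. Lang, Differential and Riemannian Manifolds, GTM 160 (1995), Ch. IV §1, Thm. 1.14 (held:
  `book:lang1995-differential-riemannian-manifolds`, PDF pp. 67–71). [Lang1995]
* J. W. Robbin, On the existence theorem for differential equations, Proc. AMS 19 (1968),
  1005–1006.
-/

noncomputable section

open Set Metric Filter Topology Function
open scoped ContDiff NNReal unitInterval

namespace Literature.Analysis.ODE

universe u

section Robbin

open unitInterval

variable {E : Type u} [NormedAddCommGroup E] [NormedSpace ℝ E] [CompleteSpace E]

omit [CompleteSpace E] in
/-- A map of class `C^ω` on an open set is real-analytic at each of its points. [folklore] -/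
theorem analyticOnNhd_of_contDiffOn_omega {F : Type*} [NormedAddCommGroup F] [NormedSpace ℝ F]
    {f : E → F} {U : Set E} (hU : IsOpen U) (hf : ContDiffOn ℝ ω f U) : AnalyticOnNhd ℝ f U :=
  fun y hy => ((hf y hy).contDiffAt (hU.mem_nhds hy)).analyticAt

/-- **The Robbin–Lang map of a `C^n` vector field is `C^n`, for every `n : ℕ∞ω`** — Lang (1995),
Ch. IV §1, Lemma 1.12 for `n ≤ ∞` (`contDiffAt_robbinMap`) and, for `n = ω`, the analyticity of
the Nemytskii operator (`contDiffAt_nemytskii_omega`). [cite: Lang1995, Ch. IV §1, Lemma 1.12] -/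
theorem contDiffAt_robbinMap_withTop {n : ℕ∞ω} {f : E → E} {U : Set E} (hU : IsOpen U)
    (hf : ContDiffOn ℝ n f U) (p : (ℝ × E) × C(I, E)) (hp : range p.2 ⊆ U) :
    ContDiffAt ℝ n (robbinMap f) p := by
  rcases eq_or_ne n ⊤ with rfl | hne
  · -- the analytic case
    have h1 : ContDiffAt ℝ ω (fun q : (ℝ × E) × C(I, E) => nemytskii f q.2) p :=
      (contDiffAt_nemytskii_omega (analyticOnNhd_of_contDiffOn_omega hU hf) p.2 hp).comp p
        contDiffAt_snd
    unfold robbinMap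
    apply ContDiffAt.sub _ contDiffAt_snd
    apply ContDiffAt.add
    · exact ((ContinuousLinearMap.const ℝ I (M := E)).contDiff.comp
        (contDiff_snd.comp contDiff_fst)).contDiffAt
    · exact (contDiff_fst.comp contDiff_fst).contDiffAt.smul
        ((primitiveCLM (E := E)).contDiff.contDiffAt.comp p h1)
  · obtain ⟨m, rfl⟩ := WithTop.ne_top_iff_exists.1 hne
    exact contDiffAt_robbinMap hU hf p hp

end Robbin

/-! ### The local flow of a `C^n` vector field is `C^n`, `n : ℕ∞ω` -/

section Flow

open unitInterval

variable {E : Type u} [NormedAddCommGroup E] [NormedSpace ℝ E] [CompleteSpace E]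

/-- **Smooth and analytic dependence on initial conditions: the local flow of a `C^n` vector field
is `C^n`, `n : ℕ∞ω`, `1 ≤ n`** (Lang, *Differential and Riemannian Manifolds* (1995), Ch. IV §1,
Thm. 1.14, also for `p = ∞` (Thm. 1.16) and `p = ω` — the real-analytic case, classically the
Cauchy–Poincaré theorem on analytic dependence on initial data). For a Banach space `E`, an open
set `U ⊆ E`, a vector field `f` of class `C^n` on `U` and `x₀ ∈ U`, there are `r, ε > 0` and a map
`φ` such that for every `x ∈ B_r(x₀)` the curve `t ↦ φ x t` is an integral curve of `f` on
`(-ε, ε)` starting at `x` and staying in `U`, and `(x, t) ↦ φ x t` is of class `C^n` on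
`B_r(x₀) × (-ε, ε)`. Proof verbatim that of `exists_contDiffOn_flow` (implicit function theorem
on `C([0, 1], E)` for the Robbin–Lang map), with `contDiffAt_robbinMap_withTop`.
[cite: Lang1995, Ch. IV §1, Thm. 1.14] -/
theorem exists_contDiffOn_localFlow {n : ℕ∞ω} {f : E → E} {U : Set E} (hU : IsOpen U)
    (hf : ContDiffOn ℝ n f U) (hn : 1 ≤ n) {x₀ : E} (hx₀ : x₀ ∈ U) :
    ∃ φ : E → ℝ → E, ∃ r > (0 : ℝ), ∃ ε > (0 : ℝ),
      (∀ x ∈ ball x₀ r, φ x 0 = x) ∧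
      (∀ x ∈ ball x₀ r, ∀ t ∈ Ioo (-ε) ε, HasDerivAt (φ x) (f (φ x t)) t) ∧
      (∀ x ∈ ball x₀ r, ∀ t ∈ Ioo (-ε) ε, φ x t ∈ U) ∧
      ContDiffOn ℝ n (fun p : E × ℝ => φ p.1 p.2) (ball x₀ r ×ˢ Ioo (-ε) ε) := by
  have hn' : (1 : WithTop ℕ∞) ≤ n := hn
  have hn0 : n ≠ 0 := (zero_lt_one.trans_le hn').ne'
  have hf1 : ContDiffOn ℝ ((1 : ℕ∞) : ℕ∞ω) f U := hf.of_le (by exact_mod_cast hn)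
  -- smoothness data on `U`
  have hdiff : ∀ y ∈ U, HasFDerivAt f (fderiv ℝ f y) y := fun y hy =>
    (hf.differentiableOn hn0).hasFDerivAt (hU.mem_nhds hy)
  have hfc' : ContinuousOn (fderiv ℝ f) U := hf.continuousOn_fderiv_of_isOpen hU hn'
  have hfc : ContinuousOn f U := hf.continuousOn
  -- a ball with bounds
  obtain ⟨a, ha, haU, M, C, hM, hC⟩ := exists_closedBall_norm_fderiv_le hU hf1 le_rfl hx₀
  -- Lipschitz on the ball
  have hlip : LipschitzOnWith C f (closedBall x₀ a) :=
    (convex_closedBall x₀ a).lipschitzOnWith_of_nnnorm_hasFDerivWithin_le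
      (fun y hy => (hdiff y (haU hy)).hasFDerivWithinAt) fun y hy => by
        have := hC y hy
        exact_mod_cast this
  -- radii and times
  set r : ℝ≥0 := a / 2 with hr
  have hr0 : (0 : ℝ) < r := by rw [hr]; exact_mod_cast half_pos ha
  set ε : ℝ := min ((a : ℝ) / (2 * (M + 1))) (1 / (2 * (C + 1))) with hε
  have hε0 : 0 < ε := lt_min (by positivity) (by positivity)
  have hεa : (M : ℝ) * ε ≤ a - r := by
    have hM0 : (0 : ℝ) ≤ M := M.2
    have ha0 : (0 : ℝ) ≤ a := a.2
    calc (M : ℝ) * ε ≤ M * (a / (2 * (M + 1))) := by gcongr; exact min_le_left _ _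
      _ = (M * a) / (2 * (M + 1)) := (mul_div_assoc _ _ _).symm
      _ ≤ a / 2 := by
          rw [div_le_div_iff₀ (by positivity) (by positivity)]
          nlinarith [mul_nonneg hM0 ha0]
      _ = a - r := by rw [hr, NNReal.coe_div, NNReal.coe_ofNat]; ring
  have hεC : ε * C < 1 := by
    have hC0 : (0 : ℝ) ≤ C := C.2
    calc ε * C ≤ (1 / (2 * (C + 1))) * C := by gcongr; exact min_le_right _ _
      _ = C / (2 * (C + 1)) := by rw [div_mul_eq_mul_div, one_mul]
      _ < 1 := by rw [div_lt_one (by positivity)]; linarith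
  -- Picard–Lindelöf data on `[-ε, ε]`
  set t₀ : Icc (-ε) ε := ⟨0, by constructor <;> linarith⟩ with ht₀
  have hpl : IsPicardLindelof (fun _ : ℝ => f) t₀ x₀ a r M C :=
    IsPicardLindelof.of_time_independent hM hlip (by
      simp only [ht₀, sub_zero, zero_sub, neg_neg, max_self]; exact hεa)
  -- the integral curves, confined to the ball, Lipschitz in time and initial condition
  have hex : ∀ x (hx : x ∈ closedBall x₀ (r : ℝ)), ∃ α : ODE.FunSpace t₀ x₀ r M,
      IsFixedPt (ODE.FunSpace.next hpl hx) α := fun x hx => ODE.FunSpace.exists_isFixedPt_next hpl hx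
  choose αf hαf using hex
  obtain ⟨L', hL'⟩ := ODE.FunSpace.exists_forall_closedBall_funSpace_dist_le_mul hpl
  classical
  let orb : E → ℝ → E := fun x =>
    if hx : x ∈ closedBall x₀ (r : ℝ) then (αf x hx).compProj else fun _ => x
  have orb_eq : ∀ x (hx : x ∈ closedBall x₀ (r : ℝ)), orb x = (αf x hx).compProj := fun x hx => by
    simp only [orb, dif_pos hx]
  have orb_cont : ∀ x, Continuous (orb x) := fun x => by
    by_cases hx : x ∈ closedBall x₀ (r : ℝ)
    · rw [orb_eq x hx]; exact (αf x hx).continuous_compProj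
    · simp only [orb, dif_neg hx]; exact continuous_const
  have orb_zero : ∀ x (hx : x ∈ closedBall x₀ (r : ℝ)), orb x 0 = x := fun x hx => by
    rw [orb_eq x hx]
    have h := ODE.FunSpace.next_apply₀ hpl hx (αf x hx)
    rw [hαf x hx] at h
    rw [show (0 : ℝ) = (t₀ : ℝ) from rfl, ODE.FunSpace.compProj_val, h]
  have orb_mem : ∀ x (hx : x ∈ closedBall x₀ (r : ℝ)) (t : ℝ), orb x t ∈ closedBall x₀ a :=
    fun x hx t => by
      rw [orb_eq x hx]; exact (αf x hx).compProj_mem_closedBall hpl.mul_max_le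
  have orb_deriv : ∀ x (hx : x ∈ closedBall x₀ (r : ℝ)), ∀ t ∈ Icc (-ε) ε,
      HasDerivWithinAt (orb x) (f (orb x t)) (Icc (-ε) ε) t := fun x hx t ht => by
    rw [orb_eq x hx]
    apply (ODE.hasDerivWithinAt_picard_Icc t₀.2 hpl.continuousOn_uncurry
      (αf x hx).continuous_compProj.continuousOn
      (fun _ _ => (αf x hx).compProj_mem_closedBall hpl.mul_max_le) x ht).congr_of_mem _ ht
    intro t' ht'
    nth_rw 1 [← hαf x hx]
    rw [ODE.FunSpace.compProj_of_mem ht', ODE.FunSpace.next_apply]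
  have orb_lip_t : ∀ x (hx : x ∈ closedBall x₀ (r : ℝ)), ∀ s ∈ Icc (-ε) ε, ∀ t ∈ Icc (-ε) ε,
      dist (orb x s) (orb x t) ≤ M * dist s t := fun x hx s hs t ht => by
    rw [orb_eq x hx, ODE.FunSpace.compProj_of_mem hs, ODE.FunSpace.compProj_of_mem ht]
    exact (αf x hx).lipschitzWith.dist_le_mul ⟨s, hs⟩ ⟨t, ht⟩
  have orb_lip_x : ∀ x (hx : x ∈ closedBall x₀ (r : ℝ)) y (hy : y ∈ closedBall x₀ (r : ℝ)) (t : ℝ),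
      dist (orb x t) (orb y t) ≤ L' * dist x y := fun x hx y hy t => by
    rw [orb_eq x hx, orb_eq y hy, ODE.FunSpace.compProj_apply, ODE.FunSpace.compProj_apply]
    refine le_trans ?_ (hL' x y hx hy (αf x hx) (αf y hy) (hαf x hx) (hαf y hy))
    rw [← ODE.FunSpace.toContinuousMap_apply_eq_apply, ← ODE.FunSpace.toContinuousMap_apply_eq_apply]
    exact ContinuousMap.dist_apply_le_dist _
  -- `f ∘ orb x` is continuous
  have forb_cont : ∀ x (hx : x ∈ closedBall x₀ (r : ℝ)), Continuous (f ∘ orb x) := fun x hx =>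
    (hfc.mono haU).comp_continuous (orb_cont x) (orb_mem x hx)
  -- the rescaled orbits as elements of `C(I, E)`
  let sol : ℝ × E → C(I, E) := fun p =>
    ⟨fun τ => orb p.2 (p.1 * τ), (orb_cont p.2).comp (continuous_const.mul continuous_subtype_val)⟩
  have sol_apply : ∀ (p : ℝ × E) (τ : I), sol p τ = orb p.2 (p.1 * τ) := fun p τ => rfl
  have mul_mem_Icc : ∀ {t : ℝ}, |t| ≤ ε → ∀ τ : I, t * τ ∈ Icc (-ε) ε := fun {t} ht τ => by
    have h1 : |t * τ| ≤ ε := by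
      rw [abs_mul, abs_of_nonneg τ.2.1]
      exact (mul_le_of_le_one_right (abs_nonneg t) τ.2.2).trans ht
    exact ⟨(abs_le.1 h1).1, (abs_le.1 h1).2⟩
  have sol_range : ∀ p : ℝ × E, p.2 ∈ closedBall x₀ (r : ℝ) → range (sol p) ⊆ closedBall x₀ a :=
    fun p hp => by rintro _ ⟨τ, rfl⟩; exact orb_mem p.2 hp _
  -- the rescaled orbits are zeros of the Robbin–Lang map
  have sol_zero : ∀ p : ℝ × E, p.2 ∈ closedBall x₀ (r : ℝ) → |p.1| < ε →
      robbinMap f (p, sol p) = 0 := by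
    rintro ⟨t, x⟩ hx ht
    ext τ
    have hcomp : Continuous (f ∘ sol (t, x)) :=
      (hfc.mono haU).comp_continuous (map_continuous _) fun τ => orb_mem x hx _
    simp only [robbinMap, ContinuousMap.sub_apply, ContinuousMap.add_apply,
      ContinuousMap.smul_apply, ContinuousLinearMap.const_apply_apply, ContinuousMap.zero_apply,
      primitiveCLM_apply]
    have hcongr : EqOn (IccExtend zero_le_one (nemytskii f (sol (t, x))))
        (fun s => f (orb x (t * s))) (uIcc 0 (τ : ℝ)) := by
      intro s hs
      have hs' : s ∈ Icc (0 : ℝ) 1 := by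
        rw [uIcc_of_le τ.2.1] at hs
        exact ⟨hs.1, hs.2.trans τ.2.2⟩
      rw [IccExtend_of_mem _ _ hs', nemytskii_apply hcomp]
      rfl
    rw [intervalIntegral.integral_congr hcongr,
      intervalIntegral.smul_integral_comp_mul_left (fun s => f (orb x s)) t, mul_zero]
    have hsub : uIcc 0 (t * τ) ⊆ Ioo (-ε) ε := by
      have h1 := mul_mem_Icc ht.le τ
      have h2 : |t * τ| < ε := by
        rw [abs_mul, abs_of_nonneg τ.2.1]
        exact lt_of_le_of_lt (mul_le_of_le_one_right (abs_nonneg t) τ.2.2) ht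
      rcases le_total 0 (t * τ) with h | h
      · rw [uIcc_of_le h]; exact fun s hs => ⟨by linarith [hs.1], lt_of_le_of_lt hs.2 (abs_lt.1 h2).2⟩
      · rw [uIcc_of_ge h]; exact fun s hs => ⟨lt_of_lt_of_le (abs_lt.1 h2).1 hs.1, by linarith [hs.2]⟩
    have hint : IntervalIntegrable (fun s => f (orb x s)) MeasureTheory.volume 0 (t * τ) :=
      (forb_cont x hx).intervalIntegrable _ _
    rw [intervalIntegral.integral_eq_sub_of_hasDerivAt (f := orb x) (f' := fun s => f (orb x s))
      (fun s hs => ?_) hint, orb_zero x hx]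
    · change x + (orb x (t * τ) - x) - orb x (t * τ) = 0
      abel
    · have hs' := hsub hs
      exact (orb_deriv x hx s (Ioo_subset_Icc_self hs')).hasDerivAt (Icc_mem_nhds hs'.1 hs'.2)
  -- continuity of `sol` into `C(I, E)` on the open domain
  have sol_contAt : ∀ p₁ : ℝ × E, p₁.2 ∈ ball x₀ (r : ℝ) → |p₁.1| < ε → ContinuousAt sol p₁ := by
    rintro ⟨t₁, x₁⟩ hx₁ ht₁
    have hdom : ∀ᶠ p : ℝ × E in 𝓝 (t₁, x₁), |p.1| < ε ∧ p.2 ∈ ball x₀ (r : ℝ) := by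
      have h1 : ∀ᶠ p : ℝ × E in 𝓝 (t₁, x₁), |p.1| < ε :=
        (continuous_abs.comp continuous_fst).continuousAt.eventually_lt continuousAt_const ht₁
      have h2 : ∀ᶠ p : ℝ × E in 𝓝 (t₁, x₁), p.2 ∈ ball x₀ (r : ℝ) :=
        continuous_snd.continuousAt.eventually_mem (isOpen_ball.mem_nhds hx₁)
      exact h1.and h2
    rw [ContinuousAt, tendsto_iff_dist_tendsto_zero]
    have hbound : ∀ᶠ p : ℝ × E in 𝓝 (t₁, x₁), dist (sol p) (sol (t₁, x₁)) ≤
        L' * dist p.2 x₁ + M * dist p.1 t₁ := by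
      filter_upwards [hdom] with p hp
      refine (ContinuousMap.dist_le (by positivity)).2 fun τ => ?_
      rw [sol_apply, sol_apply]
      calc dist (orb p.2 (p.1 * τ)) (orb x₁ (t₁ * τ))
          ≤ dist (orb p.2 (p.1 * τ)) (orb x₁ (p.1 * τ)) + dist (orb x₁ (p.1 * τ)) (orb x₁ (t₁ * τ)) :=
            dist_triangle _ _ _
        _ ≤ L' * dist p.2 x₁ + M * dist (p.1 * τ) (t₁ * τ) :=
            add_le_add (orb_lip_x p.2 (ball_subset_closedBall hp.2) x₁ (ball_subset_closedBall hx₁) _)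
              (orb_lip_t x₁ (ball_subset_closedBall hx₁) _ (mul_mem_Icc hp.1.le τ) _
                (mul_mem_Icc ht₁.le τ))
        _ ≤ L' * dist p.2 x₁ + M * dist p.1 t₁ := by
            gcongr
            rw [Real.dist_eq, Real.dist_eq, ← sub_mul, abs_mul, abs_of_nonneg τ.2.1]
            exact mul_le_of_le_one_right (abs_nonneg _) τ.2.2
    refine squeeze_zero' (Eventually.of_forall fun p => dist_nonneg) hbound ?_
    have hc : Continuous fun p : ℝ × E => (L' : ℝ) * dist p.2 x₁ + M * dist p.1 t₁ := by fun_prop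
    have := hc.tendsto (t₁, x₁)
    simpa using this
  -- smoothness of `(t, x) ↦ orb x t` at every point of the open domain
  have key : ∀ p₁ : ℝ × E, p₁.2 ∈ ball x₀ (r : ℝ) → |p₁.1| < ε →
      ContDiffAt ℝ n (fun p : ℝ × E => orb p.2 p.1) p₁ := by
    rintro ⟨t₁, x₁⟩ hx₁ ht₁
    have hx₁' : x₁ ∈ closedBall x₀ (r : ℝ) := ball_subset_closedBall hx₁
    set u : (ℝ × E) × C(I, E) := ((t₁, x₁), sol (t₁, x₁)) with hu
    have hrange : range u.2 ⊆ U := (sol_range (t₁, x₁) hx₁').trans haU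
    have hΨ : ContDiffAt ℝ n (robbinMap f) u := contDiffAt_robbinMap_withTop hU hf u hrange
    have hΨ' : HasFDerivAt (robbinMap f) (robbinDeriv f u) u :=
      hasFDerivAt_robbinMap hU hdiff hfc' u hrange
    have hinv : (fderiv ℝ (robbinMap f) u ∘L ContinuousLinearMap.inr ℝ (ℝ × E) C(I, E)).IsInvertible := by
      rw [hΨ'.fderiv]
      refine isInvertible_robbinDeriv_comp_inr hfc' u hrange (C := C)
        (fun τ => hC _ (orb_mem x₁ hx₁' _)) ?_
      calc |u.1.1| * C = |t₁| * C := rfl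
        _ ≤ ε * C := by gcongr
        _ < 1 := hεC
    have hzero : robbinMap f u = 0 := sol_zero (t₁, x₁) hx₁' ht₁
    -- the implicit function and its identification with `sol`
    have hiff := hΨ.eventually_apply_eq_iff_implicitFunction hn0 hinv
    have hG : ContDiffAt ℝ n (hΨ.implicitFunction hn0 hinv) (t₁, x₁) :=
      hΨ.contDiffAt_implicitFunction hn0 hinv
    have htend : Tendsto (fun p : ℝ × E => (p, sol p)) (𝓝 (t₁, x₁)) (𝓝 u) :=
      (continuousAt_id.prodMk (sol_contAt (t₁, x₁) hx₁ ht₁)).tendsto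
    have hdom : ∀ᶠ p : ℝ × E in 𝓝 (t₁, x₁), |p.1| < ε ∧ p.2 ∈ ball x₀ (r : ℝ) := by
      have h1 : ∀ᶠ p : ℝ × E in 𝓝 (t₁, x₁), |p.1| < ε :=
        (continuous_abs.comp continuous_fst).continuousAt.eventually_lt continuousAt_const ht₁
      have h2 : ∀ᶠ p : ℝ × E in 𝓝 (t₁, x₁), p.2 ∈ ball x₀ (r : ℝ) :=
        continuous_snd.continuousAt.eventually_mem (isOpen_ball.mem_nhds hx₁)
      exact h1.and h2
    have hev : sol =ᶠ[𝓝 (t₁, x₁)] hΨ.implicitFunction hn0 hinv := by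
      filter_upwards [htend.eventually hiff, hdom] with p hp hp'
      have h0 : robbinMap f (p, sol p) = robbinMap f u := by
        rw [hzero]; exact sol_zero p (ball_subset_closedBall hp'.2) hp'.1
      exact (hp.1 h0).symm
    have hsol : ContDiffAt ℝ n sol (t₁, x₁) := hG.congr_of_eventuallyEq hev
    have heq : (fun p : ℝ × E => orb p.2 p.1) =
        fun p => ContinuousMap.evalCLM ℝ (1 : I) (sol p) := by
      funext p
      simp [sol_apply]
    rw [heq]
    exact (ContinuousMap.evalCLM ℝ (1 : I)).contDiff.contDiffAt.comp (t₁, x₁) hsol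
  -- conclusion
  refine ⟨orb, r, hr0, ε, hε0, fun x hx => orb_zero x (ball_subset_closedBall hx),
    fun x hx t ht => (orb_deriv x (ball_subset_closedBall hx) t (Ioo_subset_Icc_self ht)).hasDerivAt
      (Icc_mem_nhds ht.1 ht.2),
    fun x hx t _ => haU (orb_mem x (ball_subset_closedBall hx) t), ?_⟩
  rintro ⟨x₁, t₁⟩ ⟨hx₁, ht₁⟩
  have ht₁' : |t₁| < ε := abs_lt.2 ⟨ht₁.1, ht₁.2⟩
  exact ((key (t₁, x₁) hx₁ ht₁').comp (x₁, t₁)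
    (contDiffAt_snd.prodMk contDiffAt_fst)).contDiffWithinAt


/-- **Analytic dependence on initial conditions** (the `C^ω` case of Lang (1995), Ch. IV §1,
Thm. 1.14; Cauchy–Poincaré): the local flow of a real-analytic vector field on an open subset of a
Banach space is real-analytic jointly in the initial condition and time.
[cite: Lang1995, Ch. IV §1, Thm. 1.14] -/
theorem exists_analyticOn_localFlow {f : E → E} {U : Set E} (hU : IsOpen U)
    (hf : AnalyticOnNhd ℝ f U) {x₀ : E} (hx₀ : x₀ ∈ U) :
    ∃ φ : E → ℝ → E, ∃ r > (0 : ℝ), ∃ ε > (0 : ℝ),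
      (∀ x ∈ ball x₀ r, φ x 0 = x) ∧
      (∀ x ∈ ball x₀ r, ∀ t ∈ Ioo (-ε) ε, HasDerivAt (φ x) (f (φ x t)) t) ∧
      (∀ x ∈ ball x₀ r, ∀ t ∈ Ioo (-ε) ε, φ x t ∈ U) ∧
      AnalyticOnNhd ℝ (fun p : E × ℝ => φ p.1 p.2) (ball x₀ r ×ˢ Ioo (-ε) ε) := by
  obtain ⟨φ, r, hr, ε, hε, h0, hd, hU', hs⟩ :=
    exists_contDiffOn_localFlow (n := ω) hU hf.contDiffOn_of_completeSpace le_top hx₀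
  refine ⟨φ, r, hr, ε, hε, h0, hd, hU', ?_⟩
  have hopen : IsOpen (ball x₀ r ×ˢ Ioo (-ε) ε) := isOpen_ball.prod isOpen_Ioo
  exact analyticOnNhd_of_contDiffOn_omega hopen hs

/-- Analytic dependence on initial conditions, global form: the local flow of a real-analytic
vector field on the whole Banach space is real-analytic near every point.
[cite: Lang1995, Ch. IV §1, Thm. 1.14] -/
theorem exists_analyticOn_localFlow_of_analyticOnNhd_univ {f : E → E}
    (hf : AnalyticOnNhd ℝ f univ) (x₀ : E) :
    ∃ φ : E → ℝ → E, ∃ r > (0 : ℝ), ∃ ε > (0 : ℝ),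
      (∀ x ∈ ball x₀ r, φ x 0 = x) ∧
      (∀ x ∈ ball x₀ r, ∀ t ∈ Ioo (-ε) ε, HasDerivAt (φ x) (f (φ x t)) t) ∧
      AnalyticOnNhd ℝ (fun p : E × ℝ => φ p.1 p.2) (ball x₀ r ×ˢ Ioo (-ε) ε) := by
  obtain ⟨φ, r, hr, ε, hε, h0, hd, -, hs⟩ := exists_analyticOn_localFlow isOpen_univ hf (mem_univ x₀)
  exact ⟨φ, r, hr, ε, hε, h0, hd, hs⟩

end Flow

end Literature.Analysis.ODE

end
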